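/-
COR-CM (cell pub-hodgecm2, stage 2 of the Hodge ladder) — PLANNER-D «delrec» row S3 (seat delrec-p5): the DelRec variant of the END
`Summit.HodgeConjecture.CorCM.D2Bridge.MuKeyEnd.hc_cm_of_printed_citations_muKey` of `Summits.HodgeConjecture.CorCM.D2Bridge.ClosedPrintedMuKey` (source bytes md5 3d2ee9d7bf32 · sha16 4c4da85aea5c8bb1, :244).  ONE change of display: the PACKAGED record binder
`h : UnitaryCanonicalModel.exists_recordSystem` ([Deligne 1979] 2.2.5 + Cor. 2.7.21 read on the tree's carriers) is replaced by the printed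
existential `hDel : UnitaryCanonicalModel.canonicalModel_exists_printed` (`Literature/AlgebraicGeometry/ShimuraVarieties/UnitaryShimuraCanonicalModelPrinted.lean`),
and `h := DelRec.exists_recordSystem_of_printed hDel` (`CorCM/DelRec/RecordSystemOfPrinted.lean`) is supplied INSIDE; the other displayed binders are the
source bytes :246–:286 under the single textual substitution `h ↦ (Summit.HodgeConjecture.CorCM.DelRec.exists_recordSystem_of_printed hDel)`
(12 sites: h21 0 · hLiuC 2 · h411 1 · h413 1 · hμsep 7 · hD1'' 1); the proof is ONE application of the source theorem.  GENERATED by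
`HOME/delrec/tools/gen_delrec_end.py`, not hand-copied.  THEOREMS ONLY; nothing landed is edited or restated; new declaration name in a new namespace.
FRAMING: HC_CM is NOT proved unconditionally (the displayed citations are hypotheses); this file claims no pointer ∕ label ∕ count move.
-/
import Summits.HodgeConjecture.CorCM.D2Bridge.ClosedPrintedMuKey
import Summits.HodgeConjecture.CorCM.DelRec.RecordSystemOfPrinted
import HarnessLib

/-!
# DelRec variant of `Summit.HodgeConjecture.CorCM.D2Bridge.MuKeyEnd.hc_cm_of_printed_citations_muKey`: `HC_CM` from the printed citations, `h` displayed as [Del79] 2.2.5 + Cor. 2.7.21 AS PRINTED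

* `hc_cm_of_printed_citations_muKey_delRec` — the source END at `h := DelRec.exists_recordSystem_of_printed hDel`.  DISPLAYED: `hDel` and, VERBATIM from the source up to
  the substitution of `h`, `h21 ∕ hLiuC ∕ h411 ∕ h413 ∕ hμsep ∕ hD1''`.  0 data binders.  HC_CM is NOT proved unconditionally; nothing displayed is inhabited here.
[Deligne1979ShimuraVarieties] 2.1.2–2.1.4, 2.2.4–2.2.5, Cor. 2.7.21; [Milne2005ShimuraVarieties] Def. 12.8 (62), Def. 12.10.
-/

set_option autoImplicit false

noncomputable section

namespace Summit.HodgeConjecture.CorCM.D2Bridge.MuKeyEndDelRec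

open scoped TensorProduct Matrix
open NumberField NumberField.InfinitePlace
open HodgeCM.Model HodgeCM.Model.LiuIndex HodgeCM.Model.TowerCarrier
open HodgeCM.Literature.Theta.LiuAlbaneseModuleDatum.D2Bridge (HcmPieces)
open Summit.HodgeConjecture.CorCM.Model
open Literature.AlgebraicGeometry.Motives (CMType)
open Literature.AlgebraicGeometry.HodgeTheory Literature.NumberTheory.Automorphic.PicardCM
open Literature.AlgebraicGeometry.ShimuraVarieties.UnitaryCanonicalModel
open Literature.NumberTheory.ComplexMultiplication
open Literature.NumberTheory.Automorphic
open Literature.NumberTheory.Automorphic.IdeleClassGroup (toHeckeCharacter isUnitary_toHeckeCharacter)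
open Literature.NumberTheory.Automorphic.Liu2021 Literature.NumberTheory.Automorphic.Liu2021.AppendixC
open Literature.NumberTheory.Automorphic.Liu2021.AppendixC.RestOne
open Literature.NumberTheory.Automorphic.Liu2021.Def411WeilCarriers (lineOf locF Rep)
open Summit.HodgeConjecture.CorCM.Transposition.OmegaTransport (realUnit)
open HodgeCM.Model.ArchSideTerm (e₁)
open Literature.NumberTheory.GelbartRogawski1991 Literature.NumberTheory.GelbartRogawski1991.UnitaryDualPair
open Literature.NumberTheory.GelbartRogawski1991.UnitaryDualPair.LocalSplitting (localMu norm_localMu continuous_localMu localMu_toLocalRing_eq_one_iff)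
open Literature.RepresentationTheory Literature.RepresentationTheory.Liu2021
open Summit.HodgeConjecture.CorCM.Transposition
open Summit.HodgeConjecture.CorCM.D2Bridge.AdapterMuConj (muConj prop413AsPrinted_muConj def411_muConj nontrivial_omegaAt_muConj_rest)
open Summit.HodgeConjecture.CorCM.D2Bridge.AdapterRelabel (isReflexOfTypeG_cmType_iff_starRingEnd_comp_galConj)
open Summit.HodgeConjecture.CorCM.D2Bridge.MuConjEnd (thm418C_indexOfRecord_of_muConj)
open Summit.HodgeConjecture.CorCM.D2Bridge.MuKeyEnd

/-! ## The END `hc_cm_of_printed_citations_muKey` with the Deligne record split: `h := DelRec.exists_recordSystem_of_printed hDel` -/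

set_option synthInstance.maxHeartbeats 400000 in
set_option maxHeartbeats 6400000 in
/-- **DelRec variant of `Summit.HodgeConjecture.CorCM.D2Bridge.MuKeyEnd.hc_cm_of_printed_citations_muKey` — `HC_CM` FROM THE PRINTED CITATIONS with the Deligne record displayed AS PRINTED.**
Displayed: `hDel` = [Deligne 1979, 2.2.5 + Cor. 2.7.21; 2.1.2–2.1.4] at the datum `(Res_{L⁺/ℚ} U(H), 𝔹²)` of [Liu 2021, App. C] — every complex record
system below a neat level admits a model over the reflex field `τ(L)`, smooth and projective ([Liu 2021, §C.1]), compatible with the transitions, on which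
`Aut(ℂ/τL)` acts at the diagonal special points by the reciprocity law (62) of [Milne 2005, Def. 12.8]
(`UnitaryCanonicalModel.canonicalModel_exists_printed`); then `h21 ∕ hLiuC ∕ h411 ∕ h413 ∕ hμsep ∕ hD1''` VERBATIM from the source END up to the substitution
`h ↦ (DelRec.exists_recordSystem_of_printed hDel)` (their print-instance readings are the source END's, unchanged).  KERNEL: ONE application of
`Summit.HodgeConjecture.CorCM.D2Bridge.MuKeyEnd.hc_cm_of_printed_citations_muKey`.  HC_CM is NOT proved unconditionally: the displayed citations are hypotheses; whether this is an edition ∕ candidate of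
record is the COORDINATOR's ∕ referees' call.
[cite: Deligne1979ShimuraVarieties, §2.1.2–2.1.4, 2.2.4–2.2.5 and Cor. 2.7.21 (PDF pp. 24, 29, 52 of Milne's translation)]
[cite: Milne2005ShimuraVarieties, Def. 12.8 (62) p. 114; Def. 12.10 p. 115] [cite: Liu2021, App. C §C.1 and Rem. C.2] -/
theorem hc_cm_of_printed_citations_muKey_delRec
    (hDel : Literature.AlgebraicGeometry.ShimuraVarieties.UnitaryCanonicalModel.canonicalModel_exists_printed)
    (h21 : shimura1998_thm21_4_casselman)
    -- [Liu21, Thm 4.18] AS PRINTED at the RELABELLED rests of 𝕌(a) (tail at `ν`, blocks `ω(νᶜ, ·, ·)`): Thm 4.18 for (X(𝕍^{(c)}), ν) under WORLD C — scalar-keyed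
    (hLiuC : ∀ (F : HodgeCM.CMField) [IsGalois ℚ F] (h6 : 6 ≤ Module.finrank ℚ F) {ι₁ : F →+* ℂ} (V : HodgeCM.HermSpace3 F ι₁) (a : RealScalar F)
      (Φ : CMType F) (hΦ : ι₁ ∈ Φ.1) (ν : Literature.NumberTheory.Automorphic.IdeleClassGroup (F : Type) →ₜ* Circle)
      (hν : IdeleClassGroup.IsConjugateSymplectic (F : Type) ν) (hw : IdeleClassGroup.HasWeight (F : Type) ν 1),
      Thm418AsPrinted (toThm418Data _ ((Summit.HodgeConjecture.CorCM.D2Bridge.AdapterMuConj.muConj (uniformOmegaRep (Summit.HodgeConjecture.CorCM.DelRec.exists_recordSystem_of_printed hDel) ⟨HodgeCM.CMField.K F⟩ ι₁ ⟨HodgeCM.HermSpace3.Hm V, HodgeCM.HermSpace3.isHermitian V, HodgeCM.HermSpace3.signature_ι₁ V, HodgeCM.HermSpace3.posDef_of_ne V⟩ Φ e₁ (frameD V) (frameD_real V) (frameD_ne V) (ιVE V) (2 * imagUnit (HodgeCM.CMField.K F))⁻¹ (fun _ _ => (Rep.update ↥(maximalRealSubfield (HodgeCM.CMField.K F)) (imagUnitSq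 (HodgeCM.CMField.K F)) (Rep.ofLineOf ↥(maximalRealSubfield (HodgeCM.CMField.K F)) (imagUnitSq (HodgeCM.CMField.K F))) (locF ↥(maximalRealSubfield (HodgeCM.CMField.K F)) (imagUnitSq (HodgeCM.CMField.K F)) (realUnit ⟨HodgeCM.CMField.K F⟩ a.1 a.2.1 a.2.2)) (realUnit ⟨HodgeCM.CMField.K F⟩ a.1 a.2.1 a.2.2) rfl)))).rest (restTailOne (AlgHom.id ℚ _) ι₁ hν hw (Def45.Carriers.ofPolDR ν (Def45.PolDR ι₁ hν (Def45.RMuForm ι₁ hν))) ((heckeTranslatesFamilyOf heckeTranslate_definedOver_holds (Summit.HodgeConjecture.CorCM.DelRec.exists_recordSystem_of_printed hDel) isoOf ⟨HodgeCM.CMField.K F⟩ ι₁ ⟨HodgeCM.HermSpace3.Hm V, HodgeCM.HermSpace3.isHermitian V, HodgeCM.HermSpace3.signature_ι₁ V, HodgeCM.HermSpace3.posDef_of_ne V⟩ Φ h6).rhoΩOne (AlgHom.id ℚ _) ι₁ hν hw (Def45.Carriers.ofPolDR ν (Def45.PolDR ι₁ hν (Def45.RMuForm ι₁ hν)))))))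)
    -- [Liu21, Def 4.11] AS PRINTED at the rests of record 𝔯δ′⟦a, μ⟧ — scalar-keyed
    (h411 : ∀ (F : HodgeCM.CMField) [IsGalois ℚ F] (h6 : 6 ≤ Module.finrank ℚ F) {ι₁ : F →+* ℂ} (V : HodgeCM.HermSpace3 F ι₁) (a : RealScalar F)
      (Φ : CMType F) (hΦ : ι₁ ∈ Φ.1) (μ : Literature.NumberTheory.Automorphic.IdeleClassGroup (F : Type) →ₜ* Circle)
      (hμ : IdeleClassGroup.IsConjugateSymplectic (F : Type) μ) (hw : IdeleClassGroup.HasWeight (F : Type) μ 1),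
      Def411AsPrinted (toThm418Data _ (restOfCharDeltaPrime (Summit.HodgeConjecture.CorCM.DelRec.exists_recordSystem_of_printed hDel) ⟨HodgeCM.CMField.K F⟩ h6 ι₁ ⟨HodgeCM.HermSpace3.Hm V, HodgeCM.HermSpace3.isHermitian V, HodgeCM.HermSpace3.signature_ι₁ V, HodgeCM.HermSpace3.posDef_of_ne V⟩ Φ e₁ (frameD V) (frameD_real V) (frameD_ne V) (ιVE V) (Rep.update ↥(maximalRealSubfield (HodgeCM.CMField.K F)) (imagUnitSq (HodgeCM.CMField.K F)) (Rep.ofLineOf ↥(maximalRealSubfield (HodgeCM.CMField.K F)) (imagUnitSq (HodgeCM.CMField.K F))) (locF ↥(maximalRealSubfield (HodgeCM.CMField.K F)) (imagUnitSq (HodgeCM.CMField.K F)) (realUnit ⟨HodgeCM.CMField.K F⟩ a.1 a.2.1 a.2.2)) (realUnit ⟨HodgeCM.CMField.K F⟩ a.1 a.2.1 a.2.2) rfl) μ hμ hw)))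
    -- [Liu21, Prop 4.13] AS PRINTED at the tower over the uniform carriers of each index line (Δ2 side only)
    (h413 : ∀ (F : HodgeCM.CMField) [IsGalois ℚ F] (h6 : 6 ≤ Module.finrank ℚ F) {ι₁ : F →+* ℂ} (V : HodgeCM.HermSpace3 F ι₁) (a₀ : RealScalar F)
      (Φ : CMType F) (hΦ : ι₁ ∈ Φ.1) (i : (I V (repAt a₀) (muLiu ι₁ GramClass.rep))), Prop413AsPrinted (((uniformOmegaRep (Summit.HodgeConjecture.CorCM.DelRec.exists_recordSystem_of_printed hDel) ⟨HodgeCM.CMField.K F⟩ ι₁ ⟨HodgeCM.HermSpace3.Hm V, HodgeCM.HermSpace3.isHermitian V, HodgeCM.HermSpace3.signature_ι₁ V, HodgeCM.HermSpace3.posDef_of_ne V⟩ Φ e₁ (frameD V) (frameD_real V) (frameD_ne V) (ιVE V) (2 * imagUnit (HodgeCM.CMField.K F))⁻¹ (fun _ _ => (Rep.update ↥(maximalRealSubfield (HodgeCM.CMField.K F)) (imagUnitSq (HodgeCM.CMField.K F)) (Rep.ofLineOf ↥(maximalRealSubfield (HodgeCM.CMField.K F)) (imagUnitSq (HodgeCM.CMField.K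 F))) (locF ↥(maximalRealSubfield (HodgeCM.CMField.K F)) (imagUnitSq (HodgeCM.CMField.K F)) (realUnit ⟨HodgeCM.CMField.K F⟩ (repAt a₀ (Sigma.fst i)).1 (repAt a₀ (Sigma.fst i)).2.1 (repAt a₀ (Sigma.fst i)).2.2)) (realUnit ⟨HodgeCM.CMField.K F⟩ (repAt a₀ (Sigma.fst i)).1 (repAt a₀ (Sigma.fst i)).2.1 (repAt a₀ (Sigma.fst i)).2.2) rfl)))).prop413Data ((liuDictionaryPin exists_isReal_hodgeModel_holds hodgePQ_independent_of_hodgeModel_holds BallQuotient.ballQuotientUniformised_holds (cmAbelianVarietyRealised_of_eigenbasis exists_isReal_hodgeModel_holds hodgePQ_independent_of_hodgeModel_holds cmAbelianVarietyEigenbasisRealised_holds) Literature.NumberTheory.Transcendental.arapura2012_cor_15_4_6_holds V (I V (repAt a₀) (muLiu ι₁ GramClass.rep)) (line V (repAt a₀) (muLiu ι₁ GramClass.rep)))).H))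
    -- the cross-μ leg of [Liu21, App. D Lem D.1 (3)] («μ = ⊗_v μ_v») per index line (Δ2 side only)
    (hμsep : ∀ (F : HodgeCM.CMField) [IsGalois ℚ F] (h6 : 6 ≤ Module.finrank ℚ F) {ι₁ : F →+* ℂ} (V : HodgeCM.HermSpace3 F ι₁) (a₀ : RealScalar F)
      (Φ : CMType F) (hΦ : ι₁ ∈ Φ.1) (i : (I V (repAt a₀) (muLiu ι₁ GramClass.rep))) (s t : (((uniformOmegaRep (Summit.HodgeConjecture.CorCM.DelRec.exists_recordSystem_of_printed hDel) ⟨HodgeCM.CMField.K F⟩ ι₁ ⟨HodgeCM.HermSpace3.Hm V, HodgeCM.HermSpace3.isHermitian V, HodgeCM.HermSpace3.signature_ι₁ V, HodgeCM.HermSpace3.posDef_of_ne V⟩ Φ e₁ (frameD V) (frameD_real V) (frameD_ne V) (ιVE V) (2 * imagUnit (HodgeCM.CMField.K F))⁻¹ (fun _ _ => (Rep.update ↥(maximalRealSubfield (HodgeCM.CMField.K F)) (imagUnitSq (HodgeCM.CMField.K F)) (Rep.ofLineOf ↥(maximalRealSubfield (HodgeCM.CMField.K F)) (imagUnitSq (HodgeCM.CMField.K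 F))) (locF ↥(maximalRealSubfield (HodgeCM.CMField.K F)) (imagUnitSq (HodgeCM.CMField.K F)) (realUnit ⟨HodgeCM.CMField.K F⟩ (repAt a₀ (Sigma.fst i)).1 (repAt a₀ (Sigma.fst i)).2.1 (repAt a₀ (Sigma.fst i)).2.2)) (realUnit ⟨HodgeCM.CMField.K F⟩ (repAt a₀ (Sigma.fst i)).1 (repAt a₀ (Sigma.fst i)).2.1 (repAt a₀ (Sigma.fst i)).2.2) rfl)))).prop413Data ((liuDictionaryPin exists_isReal_hodgeModel_holds hodgePQ_independent_of_hodgeModel_holds BallQuotient.ballQuotientUniformised_holds (cmAbelianVarietyRealised_of_eigenbasis exists_isReal_hodgeModel_holds hodgePQ_independent_of_hodgeModel_holds cmAbelianVarietyEigenbasisRealised_holds) Literature.NumberTheory.Transcendental.arapura2012_cor_15_4_6_holds V (I V (repAt a₀) (muLiu ι₁ GramClass.rep)) (line V (repAt a₀) (muLiu ι₁ GramClass.rep)))).H).AdmTriple), Nontrivial ((((uniformOmegaRep (Summit.HodgeConjecture.CorCM.DelRec.exists_recordSystem_of_printed hDel) ⟨HodgeCM.CMField.K F⟩ ι₁ ⟨HodgeCM.HermSpace3.Hm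 V, HodgeCM.HermSpace3.isHermitian V, HodgeCM.HermSpace3.signature_ι₁ V, HodgeCM.HermSpace3.posDef_of_ne V⟩ Φ e₁ (frameD V) (frameD_real V) (frameD_ne V) (ιVE V) (2 * imagUnit (HodgeCM.CMField.K F))⁻¹ (fun _ _ => (Rep.update ↥(maximalRealSubfield (HodgeCM.CMField.K F)) (imagUnitSq (HodgeCM.CMField.K F)) (Rep.ofLineOf ↥(maximalRealSubfield (HodgeCM.CMField.K F)) (imagUnitSq (HodgeCM.CMField.K F))) (locF ↥(maximalRealSubfield (HodgeCM.CMField.K F)) (imagUnitSq (HodgeCM.CMField.K F)) (realUnit ⟨HodgeCM.CMField.K F⟩ (repAt a₀ (Sigma.fst i)).1 (repAt a₀ (Sigma.fst i)).2.1 (repAt a₀ (Sigma.fst i)).2.2)) (realUnit ⟨HodgeCM.CMField.K F⟩ (repAt a₀ (Sigma.fst i)).1 (repAt a₀ (Sigma.fst i)).2.1 (repAt a₀ (Sigma.fst i)).2.2) rfl)))).prop413Data ((liuDictionaryPin exists_isReal_hodgeModel_holds hodgePQ_independent_of_hodgeModel_holds BallQuotient.ballQuotientUniformised_holds (cmAbelianVarietyRealised_of_eigenbasis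 exists_isReal_hodgeModel_holds hodgePQ_independent_of_hodgeModel_holds cmAbelianVarietyEigenbasisRealised_holds) Literature.NumberTheory.Transcendental.arapura2012_cor_15_4_6_holds V (I V (repAt a₀) (muLiu ι₁ GramClass.rep)) (line V (repAt a₀) (muLiu ι₁ GramClass.rep)))).H).omegaAt s) →
      (∃ f : (((uniformOmegaRep (Summit.HodgeConjecture.CorCM.DelRec.exists_recordSystem_of_printed hDel) ⟨HodgeCM.CMField.K F⟩ ι₁ ⟨HodgeCM.HermSpace3.Hm V, HodgeCM.HermSpace3.isHermitian V, HodgeCM.HermSpace3.signature_ι₁ V, HodgeCM.HermSpace3.posDef_of_ne V⟩ Φ e₁ (frameD V) (frameD_real V) (frameD_ne V) (ιVE V) (2 * imagUnit (HodgeCM.CMField.K F))⁻¹ (fun _ _ => (Rep.update ↥(maximalRealSubfield (HodgeCM.CMField.K F)) (imagUnitSq (HodgeCM.CMField.K F)) (Rep.ofLineOf ↥(maximalRealSubfield (HodgeCM.CMField.K F)) (imagUnitSq (HodgeCM.CMField.K F))) (locF ↥(maximalRealSubfield (HodgeCM.CMField.K F)) (imagUnitSq (HodgeCM.CMField.K F))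 (realUnit ⟨HodgeCM.CMField.K F⟩ (repAt a₀ (Sigma.fst i)).1 (repAt a₀ (Sigma.fst i)).2.1 (repAt a₀ (Sigma.fst i)).2.2)) (realUnit ⟨HodgeCM.CMField.K F⟩ (repAt a₀ (Sigma.fst i)).1 (repAt a₀ (Sigma.fst i)).2.1 (repAt a₀ (Sigma.fst i)).2.2) rfl)))).prop413Data ((liuDictionaryPin exists_isReal_hodgeModel_holds hodgePQ_independent_of_hodgeModel_holds BallQuotient.ballQuotientUniformised_holds (cmAbelianVarietyRealised_of_eigenbasis exists_isReal_hodgeModel_holds hodgePQ_independent_of_hodgeModel_holds cmAbelianVarietyEigenbasisRealised_holds) Literature.NumberTheory.Transcendental.arapura2012_cor_15_4_6_holds V (I V (repAt a₀) (muLiu ι₁ GramClass.rep)) (line V (repAt a₀) (muLiu ι₁ GramClass.rep)))).H).omegaAt s ≃ₗ[ℂ] (((uniformOmegaRep (Summit.HodgeConjecture.CorCM.DelRec.exists_recordSystem_of_printed hDel) ⟨HodgeCM.CMField.K F⟩ ι₁ ⟨HodgeCM.HermSpace3.Hm V, HodgeCM.HermSpace3.isHermitian V, HodgeCM.HermSpace3.signature_ι₁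 V, HodgeCM.HermSpace3.posDef_of_ne V⟩ Φ e₁ (frameD V) (frameD_real V) (frameD_ne V) (ιVE V) (2 * imagUnit (HodgeCM.CMField.K F))⁻¹ (fun _ _ => (Rep.update ↥(maximalRealSubfield (HodgeCM.CMField.K F)) (imagUnitSq (HodgeCM.CMField.K F)) (Rep.ofLineOf ↥(maximalRealSubfield (HodgeCM.CMField.K F)) (imagUnitSq (HodgeCM.CMField.K F))) (locF ↥(maximalRealSubfield (HodgeCM.CMField.K F)) (imagUnitSq (HodgeCM.CMField.K F)) (realUnit ⟨HodgeCM.CMField.K F⟩ (repAt a₀ (Sigma.fst i)).1 (repAt a₀ (Sigma.fst i)).2.1 (repAt a₀ (Sigma.fst i)).2.2)) (realUnit ⟨HodgeCM.CMField.K F⟩ (repAt a₀ (Sigma.fst i)).1 (repAt a₀ (Sigma.fst i)).2.1 (repAt a₀ (Sigma.fst i)).2.2) rfl)))).prop413Data ((liuDictionaryPin exists_isReal_hodgeModel_holds hodgePQ_independent_of_hodgeModel_holds BallQuotient.ballQuotientUniformised_holds (cmAbelianVarietyRealised_of_eigenbasis exists_isReal_hodgeModel_holds hodgePQ_independent_of_hodgeModel_holds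 cmAbelianVarietyEigenbasisRealised_holds) Literature.NumberTheory.Transcendental.arapura2012_cor_15_4_6_holds V (I V (repAt a₀) (muLiu ι₁ GramClass.rep)) (line V (repAt a₀) (muLiu ι₁ GramClass.rep)))).H).omegaAt t,
        ∀ (g : ↥V.adelicFin) (v : (((uniformOmegaRep (Summit.HodgeConjecture.CorCM.DelRec.exists_recordSystem_of_printed hDel) ⟨HodgeCM.CMField.K F⟩ ι₁ ⟨HodgeCM.HermSpace3.Hm V, HodgeCM.HermSpace3.isHermitian V, HodgeCM.HermSpace3.signature_ι₁ V, HodgeCM.HermSpace3.posDef_of_ne V⟩ Φ e₁ (frameD V) (frameD_real V) (frameD_ne V) (ιVE V) (2 * imagUnit (HodgeCM.CMField.K F))⁻¹ (fun _ _ => (Rep.update ↥(maximalRealSubfield (HodgeCM.CMField.K F)) (imagUnitSq (HodgeCM.CMField.K F)) (Rep.ofLineOf ↥(maximalRealSubfield (HodgeCM.CMField.K F)) (imagUnitSq (HodgeCM.CMField.K F))) (locF ↥(maximalRealSubfield (HodgeCM.CMField.K F)) (imagUnitSq (HodgeCM.CMField.K F)) (realUnit ⟨HodgeCM.CMField.K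 F⟩ (repAt a₀ (Sigma.fst i)).1 (repAt a₀ (Sigma.fst i)).2.1 (repAt a₀ (Sigma.fst i)).2.2)) (realUnit ⟨HodgeCM.CMField.K F⟩ (repAt a₀ (Sigma.fst i)).1 (repAt a₀ (Sigma.fst i)).2.1 (repAt a₀ (Sigma.fst i)).2.2) rfl)))).prop413Data ((liuDictionaryPin exists_isReal_hodgeModel_holds hodgePQ_independent_of_hodgeModel_holds BallQuotient.ballQuotientUniformised_holds (cmAbelianVarietyRealised_of_eigenbasis exists_isReal_hodgeModel_holds hodgePQ_independent_of_hodgeModel_holds cmAbelianVarietyEigenbasisRealised_holds) Literature.NumberTheory.Transcendental.arapura2012_cor_15_4_6_holds V (I V (repAt a₀) (muLiu ι₁ GramClass.rep)) (line V (repAt a₀) (muLiu ι₁ GramClass.rep)))).H).omegaAt s), f ((((uniformOmegaRep (Summit.HodgeConjecture.CorCM.DelRec.exists_recordSystem_of_printed hDel) ⟨HodgeCM.CMField.K F⟩ ι₁ ⟨HodgeCM.HermSpace3.Hm V, HodgeCM.HermSpace3.isHermitian V, HodgeCM.HermSpace3.signature_ι₁ V, HodgeCM.HermSpace3.posDef_of_ne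 V⟩ Φ e₁ (frameD V) (frameD_real V) (frameD_ne V) (ιVE V) (2 * imagUnit (HodgeCM.CMField.K F))⁻¹ (fun _ _ => (Rep.update ↥(maximalRealSubfield (HodgeCM.CMField.K F)) (imagUnitSq (HodgeCM.CMField.K F)) (Rep.ofLineOf ↥(maximalRealSubfield (HodgeCM.CMField.K F)) (imagUnitSq (HodgeCM.CMField.K F))) (locF ↥(maximalRealSubfield (HodgeCM.CMField.K F)) (imagUnitSq (HodgeCM.CMField.K F)) (realUnit ⟨HodgeCM.CMField.K F⟩ (repAt a₀ (Sigma.fst i)).1 (repAt a₀ (Sigma.fst i)).2.1 (repAt a₀ (Sigma.fst i)).2.2)) (realUnit ⟨HodgeCM.CMField.K F⟩ (repAt a₀ (Sigma.fst i)).1 (repAt a₀ (Sigma.fst i)).2.1 (repAt a₀ (Sigma.fst i)).2.2) rfl)))).prop413Data ((liuDictionaryPin exists_isReal_hodgeModel_holds hodgePQ_independent_of_hodgeModel_holds BallQuotient.ballQuotientUniformised_holds (cmAbelianVarietyRealised_of_eigenbasis exists_isReal_hodgeModel_holds hodgePQ_independent_of_hodgeModel_holds cmAbelianVarietyEigenbasisRealised_holds)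 Literature.NumberTheory.Transcendental.arapura2012_cor_15_4_6_holds V (I V (repAt a₀) (muLiu ι₁ GramClass.rep)) (line V (repAt a₀) (muLiu ι₁ GramClass.rep)))).H).rhoAt s g v) = (((uniformOmegaRep (Summit.HodgeConjecture.CorCM.DelRec.exists_recordSystem_of_printed hDel) ⟨HodgeCM.CMField.K F⟩ ι₁ ⟨HodgeCM.HermSpace3.Hm V, HodgeCM.HermSpace3.isHermitian V, HodgeCM.HermSpace3.signature_ι₁ V, HodgeCM.HermSpace3.posDef_of_ne V⟩ Φ e₁ (frameD V) (frameD_real V) (frameD_ne V) (ιVE V) (2 * imagUnit (HodgeCM.CMField.K F))⁻¹ (fun _ _ => (Rep.update ↥(maximalRealSubfield (HodgeCM.CMField.K F)) (imagUnitSq (HodgeCM.CMField.K F)) (Rep.ofLineOf ↥(maximalRealSubfield (HodgeCM.CMField.K F)) (imagUnitSq (HodgeCM.CMField.K F))) (locF ↥(maximalRealSubfield (HodgeCM.CMField.K F)) (imagUnitSq (HodgeCM.CMField.K F)) (realUnit ⟨HodgeCM.CMField.K F⟩ (repAt a₀ (Sigma.fst i)).1 (repAt a₀ (Sigma.fst i)).2.1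 (repAt a₀ (Sigma.fst i)).2.2)) (realUnit ⟨HodgeCM.CMField.K F⟩ (repAt a₀ (Sigma.fst i)).1 (repAt a₀ (Sigma.fst i)).2.1 (repAt a₀ (Sigma.fst i)).2.2) rfl)))).prop413Data ((liuDictionaryPin exists_isReal_hodgeModel_holds hodgePQ_independent_of_hodgeModel_holds BallQuotient.ballQuotientUniformised_holds (cmAbelianVarietyRealised_of_eigenbasis exists_isReal_hodgeModel_holds hodgePQ_independent_of_hodgeModel_holds cmAbelianVarietyEigenbasisRealised_holds) Literature.NumberTheory.Transcendental.arapura2012_cor_15_4_6_holds V (I V (repAt a₀) (muLiu ι₁ GramClass.rep)) (line V (repAt a₀) (muLiu ι₁ GramClass.rep)))).H).rhoAt t g (f v)) → s.1.μ = t.1.μ)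
    -- [Liu21, App. D Lem D.1 (1)] AS PRINTED per place at the local data of 𝔯δ′⟦a, μ⟧ — scalar-keyed, UNGUARDED
    (hD1'' : ∀ (F : HodgeCM.CMField) [IsGalois ℚ F] (h6 : 6 ≤ Module.finrank ℚ F) {ι₁ : F →+* ℂ} (V : HodgeCM.HermSpace3 F ι₁) (a : RealScalar F)
      (Φ : CMType F) (hΦ : ι₁ ∈ Φ.1) (μ : Literature.NumberTheory.Automorphic.IdeleClassGroup (F : Type) →ₜ* Circle)
      (hμ : IdeleClassGroup.IsConjugateSymplectic (F : Type) μ) (hw : IdeleClassGroup.HasWeight (F : Type) μ 1)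
      (j : (toThm418Data _ (restOfCharDeltaPrime (Summit.HodgeConjecture.CorCM.DelRec.exists_recordSystem_of_printed hDel) ⟨HodgeCM.CMField.K F⟩ h6 ι₁ ⟨HodgeCM.HermSpace3.Hm V, HodgeCM.HermSpace3.isHermitian V, HodgeCM.HermSpace3.signature_ι₁ V, HodgeCM.HermSpace3.posDef_of_ne V⟩ Φ e₁ (frameD V) (frameD_real V) (frameD_ne V) (ιVE V) (Rep.update ↥(maximalRealSubfield (HodgeCM.CMField.K F)) (imagUnitSq (HodgeCM.CMField.K F)) (Rep.ofLineOf ↥(maximalRealSubfield (HodgeCM.CMField.K F)) (imagUnitSq (HodgeCM.CMField.K F))) (locF ↥(maximalRealSubfield (HodgeCM.CMField.K F)) (imagUnitSq (HodgeCM.CMField.K F)) (realUnit ⟨HodgeCM.CMField.K F⟩ a.1 a.2.1 a.2.2)) (realUnit ⟨HodgeCM.CMField.K F⟩ a.1 a.2.1 a.2.2) rfl) μ hμ hw)).AdmIndex) (v : IsDedekindDomain.HeightOneSpectrum (𝓞 ↥(maximalRealSubfield (F : Type)))),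
      LemD1_1AsPrinted
        (Def411WeilCarriers.localLemD1Data ↥(maximalRealSubfield (F : Type)) (F : Type) (IsCMField.complexConj (F : Type)) 3 e₁
          (Matrix.diagonal (frameD V)) (complexConj_imagUnit (F : Type)) (imagUnit_ne_zero (F : Type)) (imagUnit_mul_self (F : Type))
          (realDiagonal_isSymm (F : Type) (frameD V) (frameD_real V)) (isUnit_det_realDiagonal (F : Type) (frameD V) (frameD_real V) (frameD_ne V))
          (realDiagonal_map (F : Type) (frameD V) (frameD_real V)).symm (((Rep.update ↥(maximalRealSubfield (HodgeCM.CMField.K F)) (imagUnitSq (HodgeCM.CMField.K F)) (Rep.ofLineOf ↥(maximalRealSubfield (HodgeCM.CMField.K F)) (imagUnitSq (HodgeCM.CMField.K F))) (locF ↥(maximalRealSubfield (HodgeCM.CMField.K F)) (imagUnitSq (HodgeCM.CMField.K F)) (realUnit ⟨HodgeCM.CMField.K F⟩ a.1 a.2.1 a.2.2)) (realUnit ⟨HodgeCM.CMField.K F⟩ a.1 a.2.1 a.2.2) rfl)).toFun j.1.1)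
          (OmegaChiSplitting.chiLocalSplittingsD ⟨HodgeCM.CMField.K F⟩ e₁ (frameD V) (frameD_real V) (frameD_ne V) (toHeckeCharacter (F : Type) μ)
            ((isOscillatorChar_toHeckeCharacter_iff μ).mpr hμ) (((Rep.update ↥(maximalRealSubfield (HodgeCM.CMField.K F)) (imagUnitSq (HodgeCM.CMField.K F)) (Rep.ofLineOf ↥(maximalRealSubfield (HodgeCM.CMField.K F)) (imagUnitSq (HodgeCM.CMField.K F))) (locF ↥(maximalRealSubfield (HodgeCM.CMField.K F)) (imagUnitSq (HodgeCM.CMField.K F)) (realUnit ⟨HodgeCM.CMField.K F⟩ a.1 a.2.1 a.2.2)) (realUnit ⟨HodgeCM.CMField.K F⟩ a.1 a.2.1 a.2.2) rfl)).toFun j.1.1))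
          (le_refl 3) (localMu (F : Type) (toHeckeCharacter (F : Type) μ))
          (fun v x => norm_localMu (F : Type) (toHeckeCharacter (F : Type) μ) v (isUnitary_toHeckeCharacter (F : Type) μ) x)
          (continuous_localMu (F : Type) (toHeckeCharacter (F : Type) μ))
          (fun v t => localMu_toLocalRing_eq_one_iff (F : Type) (toHeckeCharacter (F : Type) μ) v ((isOscillatorChar_toHeckeCharacter_iff μ).mpr hμ) t)
          j.1.2.1
          (Def411WeilCarriers.norm_chi_eq_one ↥(maximalRealSubfield (F : Type)) (F : Type) (IsCMField.complexConj (F : Type))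
            (Algebra.IsQuadraticExtension.finrank_eq_two ↥(maximalRealSubfield (F : Type)) (F : Type))
            (UnitaryGroup.algEquiv_ne_one_of_apply_eq_neg ↥(maximalRealSubfield (F : Type)) (F : Type) (IsCMField.complexConj (F : Type))
              (complexConj_imagUnit (F : Type)) (imagUnit_ne_zero (F : Type))) j.1.2)
          j.1.2.2.1 v))
    : HC_CM :=
  Summit.HodgeConjecture.CorCM.D2Bridge.MuKeyEnd.hc_cm_of_printed_citations_muKey
    (Summit.HodgeConjecture.CorCM.DelRec.exists_recordSystem_of_printed hDel) h21 hLiuC h411 h413 hμsep hD1''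

end Summit.HodgeConjecture.CorCM.D2Bridge.MuKeyEndDelRec

end
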